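import Summits.SmoothPoincare4.SmoothPoincare4.Theses.InstantonEntropy
import Literature.Topology.FourManifolds.HomotopyS4CompactProofs

/-!
# Birth skeleton for crux `InstantonEntropy.RicPosRecognition` (item stmt-SmoothPoincare4-11179)

Route `route-SmoothPoincare4-InstantonEntropy`, crux rank 3 (skeleton registrar, 2026-08-17).

Crux (fixed, never restated): every homotopy 4-sphere `M` (bare carrier exactly as in
`SmoothPoincare4`: Hausdorff, second countable, `C^∞` 4-manifold on `ℝ⁴`, `M ≃ₕ S⁴`) that carries a
`C^∞` Riemannian metric `g` with Levi-Civita connection and `Ric_g > 0` is diffeomorphic to `S⁴`.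

## The line (the route's own two-layer plan, typed abstractly)

The route's engine for this crux is `RicPosRecognition ⇐ CollarMonotone → LocalMinRicPos →
MorseMountainPass` over the `EntropyModuliPlatform` facts (route items stmt-…-6962, -6961, -7057,
-7012 — all informal because Lean has no ASD moduli space yet, definition request `AsdModuliSpace`).
The ONLY place the moduli space `M₁(M,g)` enters the argument is as an abstract connected smooth
5-manifold `N` carrying (i) a smooth exhaustion function `S` (the instanton entropy
`S(A) = ∫ |F_A|² log |F_A|²`, proper and bounded below by Uhlenbeck compactness + Jensen),
(ii) a cocompact end `Φ : M × ℝ → N` (the Donaldson–Taubes collar `M × (0,λ₀)`, `t = log(1/λ)`)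
along which `S` is strictly increasing in `t` and blows up uniformly (CollarMonotone:
`S = 32π² log(1/λ) + O(1)`, `∂_λ S < 0`), and (iii) the NO-NECK property: every critical point of `S`
is a nondegenerate local minimum (LocalMinRicPos, the bet of the route under `Ric > 0`).
So the skeleton has three stubs:

* `stub_noNeckEntropyPlatform` (HARDEST; conjectural = EntropyModuliPlatform ∧ CollarMonotone ∧
  LocalMinRicPos, witnessed by `N = M₁(M, g')` for a Freed–Uhlenbeck-generic `g'` with `Ric > 0`
  near `g` and `S` = instanton entropy): for every homotopy 4-sphere with a `Ric > 0` metric there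
  is such a no-neck Morse end-platform `(N, S, Φ)` over `M`. Stated purely over Mathlib manifolds +
  the tree's `PseudoRiemannianMetric`/`ricci`; it splits into its three gauge-theoretic children
  once `AsdModuliSpace` is definable. [Taubes1982, Uhlenbeck1982, Donaldson1983,
  FreedUhlenbeck1984, GroisserParker1989]
* `stub_mountainPassUnique` (KNOWN finite-dimensional critical-point theory = MorseMountainPass (a)):
  a smooth exhaustion function on a connected 5-manifold all of whose critical points are
  nondegenerate local minima has exactly one critical point (two strict local minima force a
  mountain-pass critical point that is not a local minimum — AmbrosettiRabinowitz1973 Thm 2.1 with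
  (PS) automatic from properness, Pucci–Serrin, JFA 59 (1984) / JDE 60 (1985); equivalently index-0 handles never merge
  components, Matsumoto2001 §3.1). [difficulty L in Lean: deformation lemma / flows on manifolds]
* `stub_morseEndRecognition` (KNOWN Morse theory = MorseMountainPass (b)): if a smooth exhaustion
  function on a connected 5-manifold has a unique critical point, a nondegenerate minimum, and the
  manifold has a cocompact `S`-monotone end `Φ : M × ℝ → N` over a compact 4-manifold `M`, then
  `M ≅ S⁴`: a far level set is a graph over `M` in the end, a near-minimum level set is a round `S⁴`
  in a Morse chart, and the normalised gradient flow (no critical values in between, regular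
  interval theorem Matsumoto2001 Thm 2.31/3.1; Morse lemma Thm 2.16) identifies them — an explicit
  flow, not the h-cobordism principle. [difficulty L–XL in Lean; the tree's
  `InformationMetricHadamardC0AhRecognitionStubFlowToRoundSphere` has the flow/level-set technology]

`RicPosRecognition_of` proves the crux BY NAME from the three stubs (compactness of `M ≃ₕ S⁴` is
the PROVED tree theorem `compactSpace_of_homotopyEquiv_sphere_four_holds`, Hatcher Prop. 3.29);
its own proof term is `sorry`-free, the only `sorry`s of the file are the three stub bodies.

## Disproof.lean honoured / negatives

No `Disproof.lean` exists for this crux (`ledger crux ls stmt-SmoothPoincare4-11179`: no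
workfiles, 2026-08-17); `ledger negatives --problem SmoothPoincare4`: 0 refuted statements. No stub
is an instance of a landed Negative lemma (there are none under `Theorems/RicPosRecognition/`).
-/

noncomputable section

-- the prescribed namespace `Summit.<P>.<Sub>.…` duplicates `SmoothPoincare4` (P = Sub)
set_option linter.dupNamespace false

open scoped Manifold ContDiff Topology ContinuousMap
open Set Function

namespace Summit.SmoothPoincare4.SmoothPoincare4.Cruxes.RicPosRecognition.Birth

open Literature.Geometry.Lorentzian (PseudoRiemannianMetric)

/-! ## Stub P — the no-neck entropy platform (HARDEST; the route's gauge-theoretic content) -/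

/-- **Stub P (no-neck entropy end-platform; = EntropyModuliPlatform ∧ CollarMonotone ∧
LocalMinRicPos of the route, typed abstractly).** For every homotopy 4-sphere `M` and every smooth
Riemannian metric `g` on `M` with Levi-Civita connection and `Ric_g > 0` there are a connected
smooth 5-manifold `N` (Hausdorff, second countable), a smooth function `S : N → ℝ` and a map
`Φ : M × ℝ → N` such that: `S` is an exhaustion (`{S ≤ c}` compact for every `c`); `Φ` is a smooth
injective immersion with cocompact range (the end of `N`); `t ↦ S (Φ (x, t))` has positive
derivative everywhere and `S ∘ Φ → +∞` as `t → +∞` uniformly in `x`; and every critical point of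
`S` is a nondegenerate local minimum (the Hessian of `S` in the extended chart at the critical
point is positive definite — intrinsic at a critical point). Intended witness: `N = M₁(M, g')`, the
charge-one anti-self-dual `SU(2)` moduli space of a Freed–Uhlenbeck-generic metric `g'` with
`Ric > 0` (a smooth 5-manifold with one end `M × (0, λ₀)`, Donaldson1983/Taubes1982), `S` the
instanton entropy `∫ |F_A|² log |F_A|²`, `Φ (x, t)` the concentrated instanton of centre `x` and
scale `λ = e^{-t}`. [cite: Donaldson1983; Taubes1982; FreedUhlenbeck1984; GroisserParker1989] -/
theorem stub_noNeckEntropyPlatform :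
    ∀ (M : Type) [TopologicalSpace M] [T2Space M] [SecondCountableTopology M]
      [ChartedSpace (EuclideanSpace ℝ (Fin 4)) M] [IsManifold (𝓡 4) ∞ M],
      M ≃ₕ Metric.sphere (0 : EuclideanSpace ℝ (Fin 5)) 1 →
    ∀ (g : PseudoRiemannianMetric (𝓡 4) ∞ (EuclideanSpace ℝ (Fin 4)) (TangentSpace (𝓡 4) : M → Type _))
      (_ : g.HasLeviCivita), g.IsRiemannian →
      (∀ (x : M) (v : TangentSpace (𝓡 4) x), v ≠ 0 → 0 < g.ricci x v v) →
    ∃ (N : Type) (_ : TopologicalSpace N) (_ : T2Space N) (_ : SecondCountableTopology N)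
      (_ : ChartedSpace (EuclideanSpace ℝ (Fin 5)) N) (_ : IsManifold (𝓡 5) ∞ N) (_ : ConnectedSpace N)
      (S : N → ℝ) (Φ : M × ℝ → N),
      ContMDiff (𝓡 5) 𝓘(ℝ, ℝ) ∞ S ∧
      (∀ c : ℝ, IsCompact (S ⁻¹' Set.Iic c)) ∧
      ContMDiff ((𝓡 4).prod 𝓘(ℝ, ℝ)) (𝓡 5) ∞ Φ ∧
      Function.Injective Φ ∧
      (∀ q : M × ℝ, Function.Injective (mfderiv ((𝓡 4).prod 𝓘(ℝ, ℝ)) (𝓡 5) Φ q)) ∧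
      IsCompact (Set.range Φ)ᶜ ∧
      (∀ (x : M) (t : ℝ), 0 < deriv (fun s : ℝ => S (Φ (x, s))) t) ∧
      (∀ C : ℝ, ∃ T : ℝ, ∀ (x : M) (t : ℝ), T ≤ t → C ≤ S (Φ (x, t))) ∧
      (∀ p : N, mfderiv (𝓡 5) 𝓘(ℝ, ℝ) S p = 0 →
        ∀ v : EuclideanSpace ℝ (Fin 5), v ≠ 0 →
          0 < fderiv ℝ (fderiv ℝ (S ∘ (extChartAt (𝓡 5) p).symm)) (extChartAt (𝓡 5) p p) v v) := by
  sorry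

/-! ## Stub U — mountain pass: only nondegenerate minima ⇒ exactly one critical point (KNOWN) -/

/-- **Stub U (mountain-pass uniqueness; MorseMountainPass (a)).** On a connected smooth 5-manifold,
a smooth exhaustion function all of whose critical points are nondegenerate local minima
(positive-definite chart Hessian at every zero of `dS`) has exactly one critical point.
(Existence: the minimum of an exhaustion function. Uniqueness: two strict local minima of a
function satisfying (PS) — automatic for an exhaustion of a finite-dimensional manifold — yield a
min-max critical point over the paths joining them which is not a local minimum,
AmbrosettiRabinowitz1973 Thm 2.1 + Pucci–Serrin 1984/85; or: a Morse function with index-0 critical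
points only has sublevel sets `⊔ D⁵`, one disc per critical point, whose components never merge,
Matsumoto2001 §3.1.) A compact `N` is excluded by the hypotheses (its maximum would be a critical
point that is not a minimum), so no non-compactness assumption is needed.
[cite: AmbrosettiRabinowitz1973, Thm 2.1; Matsumoto2001, Thm 3.1 and §3.1] -/
theorem stub_mountainPassUnique :
    ∀ (N : Type) [TopologicalSpace N] [T2Space N] [SecondCountableTopology N]
      [ChartedSpace (EuclideanSpace ℝ (Fin 5)) N] [IsManifold (𝓡 5) ∞ N] [ConnectedSpace N]
      (S : N → ℝ), ContMDiff (𝓡 5) 𝓘(ℝ, ℝ) ∞ S → (∀ c : ℝ, IsCompact (S ⁻¹' Set.Iic c)) →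
      (∀ p : N, mfderiv (𝓡 5) 𝓘(ℝ, ℝ) S p = 0 →
        ∀ v : EuclideanSpace ℝ (Fin 5), v ≠ 0 →
          0 < fderiv ℝ (fderiv ℝ (S ∘ (extChartAt (𝓡 5) p).symm)) (extChartAt (𝓡 5) p p) v v) →
      ∃ p₀ : N, ∀ p : N, mfderiv (𝓡 5) 𝓘(ℝ, ℝ) S p = 0 ↔ p = p₀ := by
  sorry

/-! ## Stub R — Morse recognition of the end cross-section (KNOWN) -/

/-- **Stub R (Morse lemma + regular interval theorem; MorseMountainPass (b)).** Let `S` be a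
smooth exhaustion function on a connected smooth 5-manifold `N` with a unique critical point `p₀`,
a nondegenerate minimum (positive-definite chart Hessian), and let `Φ : M × ℝ → N` be a smooth
injective immersion of `M × ℝ`, `M` a compact smooth 4-manifold, with cocompact range, along which
`t ↦ S (Φ (x, t))` has positive derivative and tends to `+∞` uniformly in `x`. Then `M ≅ S⁴`:
every level `S⁻¹(c)` with `c` above `max S` on the compact set `(range Φ)ᶜ ∪ Φ (M × {0})` lies in
the end and is the graph `{Φ (x, t_c x)}` over `M` (intermediate value + implicit function theorem),
a level `S⁻¹(S p₀ + ε)` is a round 4-sphere in a Morse chart at `p₀` (Morse lemma,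
Matsumoto2001 Thm 2.16), and the flow of a vector field `X` with `dS(X) = 1` on
`{S > S p₀ + ε/2}` (no critical points there) carries the one level onto the other (regular interval
theorem, Matsumoto2001 Thm 2.31/3.1); two injective immersions of closed 4-manifolds with the same
image give the diffeomorphism. The trivialised region `{S p₀ + ε ≤ S ≤ c}` is an h-cobordism made a
product by an explicit flow, not by the h-cobordism principle. If `M = ∅` the hypotheses are
contradictory (`N` would be compact). [cite: Matsumoto2001, Thm 2.16, Thm 2.31, Thm 3.1] -/
theorem stub_morseEndRecognition :
    ∀ (N : Type) [TopologicalSpace N] [T2Space N] [SecondCountableTopology N]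
      [ChartedSpace (EuclideanSpace ℝ (Fin 5)) N] [IsManifold (𝓡 5) ∞ N] [ConnectedSpace N]
      (S : N → ℝ), ContMDiff (𝓡 5) 𝓘(ℝ, ℝ) ∞ S → (∀ c : ℝ, IsCompact (S ⁻¹' Set.Iic c)) →
    ∀ p₀ : N, (∀ p : N, mfderiv (𝓡 5) 𝓘(ℝ, ℝ) S p = 0 ↔ p = p₀) →
      (∀ v : EuclideanSpace ℝ (Fin 5), v ≠ 0 →
        0 < fderiv ℝ (fderiv ℝ (S ∘ (extChartAt (𝓡 5) p₀).symm)) (extChartAt (𝓡 5) p₀ p₀) v v) →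
    ∀ (M : Type) [TopologicalSpace M] [T2Space M] [SecondCountableTopology M] [CompactSpace M]
      [ChartedSpace (EuclideanSpace ℝ (Fin 4)) M] [IsManifold (𝓡 4) ∞ M] (Φ : M × ℝ → N),
      ContMDiff ((𝓡 4).prod 𝓘(ℝ, ℝ)) (𝓡 5) ∞ Φ → Function.Injective Φ →
      (∀ q : M × ℝ, Function.Injective (mfderiv ((𝓡 4).prod 𝓘(ℝ, ℝ)) (𝓡 5) Φ q)) →
      IsCompact (Set.range Φ)ᶜ →
      (∀ (x : M) (t : ℝ), 0 < deriv (fun s : ℝ => S (Φ (x, s))) t) →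
      (∀ C : ℝ, ∃ T : ℝ, ∀ (x : M) (t : ℝ), T ≤ t → C ≤ S (Φ (x, t))) →
      Nonempty (Diffeomorph (𝓡 4) (𝓡 4) M (Metric.sphere (0 : EuclideanSpace ℝ (Fin 5)) 1) ∞) := by
  sorry

/-! ## The composition (kernel-checked; no `sorry` of its own) -/

/-- **The birth skeleton concludes the crux BY NAME.** Given a homotopy 4-sphere `M` with a
`Ric > 0` metric: `M` is compact (proved tree theorem, Hatcher Prop. 3.29); stub P supplies the
no-neck entropy platform `(N, S, Φ)`; stub U its unique critical point `p₀` (a nondegenerate minimum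
by the platform's no-neck clause); stub R the diffeomorphism `M ≅ S⁴`. -/
theorem RicPosRecognition_of :
    Summit.SmoothPoincare4.SmoothPoincare4.Theses.InstantonEntropy.RicPosRecognition := by
  intro M _ _ _ _ _ e hg
  obtain ⟨g, hLC, hRiem, hRic⟩ := hg
  haveI : CompactSpace M :=
    Literature.Topology.FourManifolds.compactSpace_of_homotopyEquiv_sphere_four_holds M e
  obtain ⟨N, _, _, _, _, _, _, S, Φ, hS, hexh, hΦ, hinj, himm, hcpt, hmono, hblow, hmin⟩ :=
    stub_noNeckEntropyPlatform M e g hLC hRiem hRic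
  obtain ⟨p₀, hp₀⟩ := stub_mountainPassUnique N S hS hexh hmin
  have hcrit : mfderiv (𝓡 5) 𝓘(ℝ, ℝ) S p₀ = 0 := (hp₀ p₀).2 rfl
  exact stub_morseEndRecognition N S hS hexh p₀ hp₀ (hmin p₀ hcrit) M Φ hΦ hinj himm hcpt hmono
    hblow

end Summit.SmoothPoincare4.SmoothPoincare4.Cruxes.RicPosRecognition.Birth

end
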